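import Summits.ValiantsHypothesis.ValiantsHypothesis.Theorems.AnyonJetsJetConstantElimMultiplierBypassAssembly

/-!
# AnyonJets — crux `JetConstantElim` (stmt-ValiantsHypothesis-16737), line `birth`, multiplier
# bypass, SHARP FORM: only the 2-adic depth of the multiplier matters

The Boolean half of the bypass (`cfUltimate_of_perModPowBooleanHard`) dissolves every integer
multiplier `M = 2^e·m` (`m` odd) whose 2-ADIC VALUATION `e = v₂(M)` is polynomially bounded — the
odd part `m` is inverted modulo `2^{k+e}` whatever its size. The assembled bypass
(`…MultiplierBypassAssembly.lean`) asked the integral normal form for the cruder `log₂ M ≤ poly`.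
This file records the sharp form, in which the extra conjunct on the registered
`stub_integralMultiple` is only

  `padicValNat 2 M ≤ (Q.size + n + 2)^b₁`   ("no deep towers of the constant `1/2`"):

* `closes_ultimate_twoAdic : CF^ult → CE^ult₂ → UniformJetUpperBound → ValiantsHypothesis`, with
  `CE^ult₂ := ∃ b ∀ n ∀ k ≤ log₂ n ∃ M ≥ 1, v₂(M) ≤ (L+n+2)^b ∧ τ(M·J_(n,k)) ≤ (L+n+2)^b`;
* `jetConstantElimUltimateTwoAdic_of : stub_algebraicDescent → stub_integralMultiple₂ →
  stub_signSimulation → CE^ult₂` (`stub_integralMultiple₂` = the registered stub + the `v₂` conjunct);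
* `valiant_of_perModPowBooleanHard_of_integralMultipleTwoAdic`,
  `jetExponentUnbounded_of_perModPowBooleanHard_of_integralMultipleTwoAdic` — the route and its
  target on the two open hypotheses `PerModPowBooleanHard`, `stub_integralMultiple₂`;
* `jetConstantElimUltimateTwoAdic_of_ultimate` — `CE^ult → CE^ult₂` (`v₂ ≤ log₂`).

Why this is the honest residual. In the route's intended mechanism for `stub_integralMultiple`
(constants in a number field `ℚ(θ)` of polynomial degree and height; regular representation of
`ℤ[θ]`; "exponent balancing turns the common denominator `N` into `M = N^e`, `e ≤ 2^{size}`") the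
multiplier's bit-length `e·log N` can be EXPONENTIAL (a circuit may square `1/N` repeatedly), so
`log₂ M ≤ poly` is a genuine strengthening; but only `v₂(M) = e·v₂(N)` has to be small for the
Boolean shadow, and that is automatic whenever `N` is ODD (in particular when the constants are
algebraic integers up to odd denominators: then even `M` odd, and with algebraic-integer constants
`M = 1`). What the bypass cannot absorb is exactly a deep tower of powers of `1/2` — the
"divisions by two" of Koiran–Perifel 2011, Rem. 4 / Bürgisser 2009, Thm. 2.10, now isolated as the
`v₂` conjunct. Honest framing: CONDITIONAL bookkeeping; both hypotheses open; VP ≠ VNP NOT proved.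

References: P. Koiran, S. Perifel, *Interpolation in Valiant's theory*, Comput. Complexity 20
(2011), Rem. 4 ("divisions by two occur"); P. Bürgisser, *On defining integers …*, Comput.
Complexity 18 (2009), Thm. 2.10; L. G. Valiant, *The complexity of computing the permanent*,
TCS 8 (1979), §4.
-/

noncomputable section

-- single-conjunct layout: Sub = Summit, duplicated namespace component intended
set_option linter.dupNamespace false

namespace Summit.ValiantsHypothesis.ValiantsHypothesis.Theorems.AnyonJets.JetConstantElim

open MvPolynomial Literature.Computability.AlgebraicComplexity
open Summit.ValiantsHypothesis.ValiantsHypothesis.Theses.AnyonJets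
open Summit.ValiantsHypothesis.ValiantsHypothesis.Theorems.AnyonJets.ConstantFreeJetGrowth (jet)

/-- **`closes_ultimate_twoAdic : CF^ult → CE^ult₂ → U → VH`** — as `closes_ultimate`, with the
multiplier constrained only 2-adically (`v₂(M) ≤ (L+n+2)^b`), which is all `CF^ult` consumes.
[folklore] -/
theorem closes_ultimate_twoAdic
    (hCF : ∀ c : ℕ, ∃ k : ℕ, 1 ≤ k ∧ ∀ n₀ : ℕ, ∃ n : ℕ, n₀ ≤ n ∧ ∀ M : ℕ, 1 ≤ M →
      padicValNat 2 M ≤ n ^ c → n ^ c ≤ constantFreeComplexity ((M : ℤ) • jet n k))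
    (hCE : ∃ b : ℕ, ∀ n k : ℕ, k ≤ Nat.log 2 n → ∃ M : ℕ, 1 ≤ M ∧
      padicValNat 2 M ≤ (complexity (MvPolynomial.map (Int.castRingHom ℂ) (jet n k)) + n + 2) ^ b ∧
      constantFreeComplexity ((M : ℤ) • jet n k) ≤
        (complexity (MvPolynomial.map (Int.castRingHom ℂ) (jet n k)) + n + 2) ^ b)
    (hU : UniformJetUpperBound) : _root_.ValiantsHypothesis := by
  show Literature.Computability.AlgebraicComplexity.VP ℂ ≠ Literature.Computability.AlgebraicComplexity.VNP ℂ
  intro hEq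
  obtain ⟨c, n₀, hc⟩ := (uniformJetUpperBound_iff_jet.mp hU) hEq
  obtain ⟨b, hb⟩ := hCE
  obtain ⟨k, hk1, hk⟩ := hCF ((c + 2) * b + 1)
  obtain ⟨n, hn, hτ⟩ := hk (max n₀ (max (2 ^ k) 3))
  have hn₀ : n₀ ≤ n := le_trans (le_max_left _ _) hn
  have h2k : 2 ^ k ≤ n := le_trans (le_trans (le_max_left _ _) (le_max_right _ _)) hn
  have h3 : 3 ≤ n := le_trans (le_trans (le_max_right _ _) (le_max_right _ _)) hn
  have hklog : k ≤ Nat.log 2 n := Nat.le_log_of_pow_le (by norm_num) h2k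
  obtain ⟨M, hM, hvM, hτM⟩ := hb n k hklog
  have hUn := hc n hn₀ k
  set L := complexity (MvPolynomial.map (Int.castRingHom ℂ) (jet n k)) with hL
  have hn1 : 1 ≤ n := by omega
  have hpow1 : n ≤ n ^ (c + 1) := by
    calc n = n ^ 1 := (pow_one n).symm
      _ ≤ n ^ (c + 1) := Nat.pow_le_pow_right hn1 (by omega)
  have hpow2 : n ^ c ≤ n ^ (c + 1) := Nat.pow_le_pow_right hn1 (by omega)
  have hsum : L + n + 2 ≤ n ^ (c + 2) := by
    have : L + n + 2 ≤ 3 * n ^ (c + 1) := by omega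
    calc L + n + 2 ≤ 3 * n ^ (c + 1) := this
      _ ≤ n * n ^ (c + 1) := Nat.mul_le_mul_right _ h3
      _ = n ^ (c + 2) := by ring
  have hXb : (L + n + 2) ^ b ≤ n ^ ((c + 2) * b) := by
    calc (L + n + 2) ^ b ≤ (n ^ (c + 2)) ^ b := Nat.pow_le_pow_left hsum b
      _ = n ^ ((c + 2) * b) := by rw [← pow_mul]
  have hlt : n ^ ((c + 2) * b) < n ^ ((c + 2) * b + 1) := Nat.pow_lt_pow_right (by omega) (by omega)
  have hv : padicValNat 2 M ≤ n ^ ((c + 2) * b + 1) := by omega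
  have hchain : n ^ ((c + 2) * b + 1) ≤ n ^ ((c + 2) * b) :=
    calc n ^ ((c + 2) * b + 1) ≤ constantFreeComplexity ((M : ℤ) • jet n k) := hτ M hM hv
      _ ≤ (L + n + 2) ^ b := hτM
      _ ≤ n ^ ((c + 2) * b) := hXb
  omega

/-- `CE^ult → CE^ult₂` (`v₂(M) ≤ log₂ M`). [folklore] -/
theorem jetConstantElimUltimateTwoAdic_of_ultimate
    (hCE : ∃ b : ℕ, ∀ n k : ℕ, k ≤ Nat.log 2 n → ∃ M : ℕ, 1 ≤ M ∧
      Nat.log 2 M ≤ (complexity (MvPolynomial.map (Int.castRingHom ℂ) (jet n k)) + n + 2) ^ b ∧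
      constantFreeComplexity ((M : ℤ) • jet n k) ≤
        (complexity (MvPolynomial.map (Int.castRingHom ℂ) (jet n k)) + n + 2) ^ b) :
    ∃ b : ℕ, ∀ n k : ℕ, k ≤ Nat.log 2 n → ∃ M : ℕ, 1 ≤ M ∧
      padicValNat 2 M ≤ (complexity (MvPolynomial.map (Int.castRingHom ℂ) (jet n k)) + n + 2) ^ b ∧
      constantFreeComplexity ((M : ℤ) • jet n k) ≤
        (complexity (MvPolynomial.map (Int.castRingHom ℂ) (jet n k)) + n + 2) ^ b := by
  obtain ⟨b, hb⟩ := hCE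
  refine ⟨b, fun n k hk => ?_⟩
  obtain ⟨M, hM, hlog, hτ⟩ := hb n k hk
  exact ⟨M, hM, (padicValNat_le_nat_log M).trans hlog, hτ⟩

/-- **`CE^ult₂` without multiplier removal, sharp form**: `stub_algebraicDescent` (landed),
`stub_signSimulation` (landed) and `stub_integralMultiple₂` — the registered `stub_integralMultiple`
plus the 2-adic conjunct `padicValNat 2 M ≤ (Q.size + n + 2)^b₁` — give constant elimination up to
a multiplier of polynomial 2-adic depth (exponent `b₁ b₂ + b₁`). [folklore] -/
theorem jetConstantElimUltimateTwoAdic_of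
    (hD : ∀ (σ : Type) (f : MvPolynomial σ ℤ),
      ∃ Q : Literature.Computability.AlgebraicComplexity.ArithCircuit (AlgebraicClosure ℚ) σ,
        Q.IsFanInTwo ∧
        Q.Computes (MvPolynomial.map (Int.castRingHom (AlgebraicClosure ℚ)) f) ∧
        Q.size ≤ Literature.Computability.AlgebraicComplexity.complexity
          (MvPolynomial.map (Int.castRingHom ℂ) f))
    (hI : let J := fun (n k : ℕ) => (∑ σ : Equiv.Perm (Fin n), MvPolynomial.C (((Equiv.Perm.sign σ : ℤˣ) : ℤ) * (((Finset.univ.filter (fun p : Fin n × Fin n => p.1 < p.2 ∧ σ p.2 < σ p.1)).card.choose k : ℕ) : ℤ)) * ∏ i : Fin n, MvPolynomial.X (σ i, i) : MvPolynomial (Fin n × Fin n) ℤ);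
      ∃ b₁ : ℕ, ∀ n k : ℕ, k ≤ Nat.log 2 n →
        ∀ Q : Literature.Computability.AlgebraicComplexity.ArithCircuit (AlgebraicClosure ℚ) (Fin n × Fin n),
          Q.IsFanInTwo →
          Q.Computes (MvPolynomial.map (Int.castRingHom (AlgebraicClosure ℚ)) (J n k)) →
          ∃ (P : Literature.Computability.AlgebraicComplexity.ArithCircuit ℤ (Fin n × Fin n)) (t M : ℕ),
            1 ≤ M ∧ P.IsFanInTwo ∧ P.Computes ((M : ℤ) • J n k) ∧
            ((∀ g ∈ P.gates, ∀ u ∈ g.args, ∀ c : ℤ, u = .const c → c.natAbs ≤ 2 ^ t) ∧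
              (∀ args : List (ℤ × Literature.Computability.AlgebraicComplexity.ArithCircuit.Operand ℤ (Fin n × Fin n)),
                Literature.Computability.AlgebraicComplexity.ArithCircuit.Gate.sum args ∈ P.gates →
                  ∀ a ∈ args, a.1.natAbs ≤ 2 ^ t) ∧
              (∀ c : ℤ, P.output = .const c → c.natAbs ≤ 2 ^ t)) ∧
            P.size + t + 2 ≤ (Q.size + n + 2) ^ b₁ ∧ padicValNat 2 M ≤ (Q.size + n + 2) ^ b₁)
    (hS : ∃ b₂ : ℕ, ∀ (σ : Type) (f : MvPolynomial σ ℤ)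
      (P : Literature.Computability.AlgebraicComplexity.ArithCircuit ℤ σ) (t : ℕ),
      P.IsFanInTwo → P.Computes f →
      ((∀ g ∈ P.gates, ∀ u ∈ g.args, ∀ c : ℤ, u = .const c → c.natAbs ≤ 2 ^ t) ∧
        (∀ args : List (ℤ × Literature.Computability.AlgebraicComplexity.ArithCircuit.Operand ℤ σ),
          Literature.Computability.AlgebraicComplexity.ArithCircuit.Gate.sum args ∈ P.gates →
            ∀ a ∈ args, a.1.natAbs ≤ 2 ^ t) ∧
        (∀ c : ℤ, P.output = .const c → c.natAbs ≤ 2 ^ t)) →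
      Literature.Computability.AlgebraicComplexity.constantFreeComplexity f ≤ (P.size + t + 2) ^ b₂) :
    ∃ b : ℕ, ∀ n k : ℕ, k ≤ Nat.log 2 n → ∃ M : ℕ, 1 ≤ M ∧
      padicValNat 2 M ≤ (complexity (MvPolynomial.map (Int.castRingHom ℂ) (jet n k)) + n + 2) ^ b ∧
      constantFreeComplexity ((M : ℤ) • jet n k) ≤
        (complexity (MvPolynomial.map (Int.castRingHom ℂ) (jet n k)) + n + 2) ^ b := by
  obtain ⟨b₁, hb₁⟩ := hI
  obtain ⟨b₂, hb₂⟩ := hS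
  refine ⟨b₁ * b₂ + b₁, fun n k hk => ?_⟩
  obtain ⟨Q, hQ2, hQc, hQs⟩ := hD (Fin n × Fin n) (jet n k)
  obtain ⟨P, t, M, hM, hP2, hPc, hPb, hPs, hvM⟩ := hb₁ n k hk Q hQ2 hQc
  have hτM : constantFreeComplexity ((M : ℤ) • jet n k) ≤ (P.size + t + 2) ^ b₂ :=
    hb₂ (Fin n × Fin n) _ P t hP2 hPc hPb
  set L := complexity (MvPolynomial.map (Int.castRingHom ℂ) (jet n k)) with hL
  set X := Q.size + n + 2 with hX
  have hXL : X ≤ L + n + 2 := by omega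
  have hL1 : 1 ≤ L + n + 2 := by omega
  refine ⟨M, hM, ?_, ?_⟩
  · calc padicValNat 2 M ≤ X ^ b₁ := hvM
      _ ≤ (L + n + 2) ^ b₁ := Nat.pow_le_pow_left hXL _
      _ ≤ (L + n + 2) ^ (b₁ * b₂ + b₁) := Nat.pow_le_pow_right hL1 (by omega)
  · calc constantFreeComplexity ((M : ℤ) • jet n k) ≤ (P.size + t + 2) ^ b₂ := hτM
      _ ≤ (X ^ b₁) ^ b₂ := Nat.pow_le_pow_left hPs _
      _ = X ^ (b₁ * b₂) := by rw [← pow_mul]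
      _ ≤ (L + n + 2) ^ (b₁ * b₂) := Nat.pow_le_pow_left hXL _
      _ ≤ (L + n + 2) ^ (b₁ * b₂ + b₁) := Nat.pow_le_pow_right hL1 (by omega)

/-- **The route's TARGET, sharp form**: `CF^ult → CE^ult₂ → JetExponentUnbounded`. [folklore] -/
theorem jetExponentUnbounded_of_ultimate_twoAdic
    (hCF : ∀ c : ℕ, ∃ k : ℕ, 1 ≤ k ∧ ∀ n₀ : ℕ, ∃ n : ℕ, n₀ ≤ n ∧ ∀ M : ℕ, 1 ≤ M →
      padicValNat 2 M ≤ n ^ c → n ^ c ≤ constantFreeComplexity ((M : ℤ) • jet n k))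
    (hCE : ∃ b : ℕ, ∀ n k : ℕ, k ≤ Nat.log 2 n → ∃ M : ℕ, 1 ≤ M ∧
      padicValNat 2 M ≤ (complexity (MvPolynomial.map (Int.castRingHom ℂ) (jet n k)) + n + 2) ^ b ∧
      constantFreeComplexity ((M : ℤ) • jet n k) ≤
        (complexity (MvPolynomial.map (Int.castRingHom ℂ) (jet n k)) + n + 2) ^ b) :
    JetExponentUnbounded := by
  refine jetExponentUnbounded_iff_jet.mpr fun c => ?_
  obtain ⟨b, hb⟩ := hCE
  obtain ⟨k, -, hk⟩ := hCF ((c + 2) * b + 1)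
  refine ⟨k, fun n₀ => ?_⟩
  obtain ⟨n, hn, hτ⟩ := hk (max n₀ (max (2 ^ k) 3))
  have hn₀ : n₀ ≤ n := le_trans (le_max_left _ _) hn
  have h2k : 2 ^ k ≤ n := le_trans (le_trans (le_max_left _ _) (le_max_right _ _)) hn
  have h3 : 3 ≤ n := le_trans (le_trans (le_max_right _ _) (le_max_right _ _)) hn
  have hklog : k ≤ Nat.log 2 n := Nat.le_log_of_pow_le (by norm_num) h2k
  refine ⟨n, hn₀, ?_⟩
  obtain ⟨M, hM, hvM, hτM⟩ := hb n k hklog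
  set L := complexity (MvPolynomial.map (Int.castRingHom ℂ) (jet n k)) with hL
  by_contra hle
  push Not at hle
  have hn1 : 1 ≤ n := by omega
  have hpow1 : n ≤ n ^ (c + 1) := by
    calc n = n ^ 1 := (pow_one n).symm
      _ ≤ n ^ (c + 1) := Nat.pow_le_pow_right hn1 (by omega)
  have hpow2 : n ^ c ≤ n ^ (c + 1) := Nat.pow_le_pow_right hn1 (by omega)
  have hsum : L + n + 2 ≤ n ^ (c + 2) := by
    have : L + n + 2 ≤ 3 * n ^ (c + 1) := by omega
    calc L + n + 2 ≤ 3 * n ^ (c + 1) := this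
      _ ≤ n * n ^ (c + 1) := Nat.mul_le_mul_right _ h3
      _ = n ^ (c + 2) := by ring
  have hXb : (L + n + 2) ^ b ≤ n ^ ((c + 2) * b) := by
    calc (L + n + 2) ^ b ≤ (n ^ (c + 2)) ^ b := Nat.pow_le_pow_left hsum b
      _ = n ^ ((c + 2) * b) := by rw [← pow_mul]
  have hlt : n ^ ((c + 2) * b) < n ^ ((c + 2) * b + 1) := Nat.pow_lt_pow_right (by omega) (by omega)
  have hv : padicValNat 2 M ≤ n ^ ((c + 2) * b + 1) := by omega
  have hchain : n ^ ((c + 2) * b + 1) ≤ n ^ ((c + 2) * b) :=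
    calc n ^ ((c + 2) * b + 1) ≤ constantFreeComplexity ((M : ℤ) • jet n k) := hτ M hM hv
      _ ≤ (L + n + 2) ^ b := hτM
      _ ≤ n ^ ((c + 2) * b) := hXb
  omega

/-- **Route AnyonJets on two hypotheses, sharp form**:
`PerModPowBooleanHard → stub_integralMultiple₂ → VP_ℂ ≠ VNP_ℂ` — the integral normal form need only
avoid deep towers of the constant `1/2`. CONDITIONAL: both hypotheses are open. [folklore] -/
theorem valiant_of_perModPowBooleanHard_of_integralMultipleTwoAdic
    (hHard : PerModPowBooleanHard)
    (hI : let J := fun (n k : ℕ) => (∑ σ : Equiv.Perm (Fin n), MvPolynomial.C (((Equiv.Perm.sign σ : ℤˣ) : ℤ) * (((Finset.univ.filter (fun p : Fin n × Fin n => p.1 < p.2 ∧ σ p.2 < σ p.1)).card.choose k : ℕ) : ℤ)) * ∏ i : Fin n, MvPolynomial.X (σ i, i) : MvPolynomial (Fin n × Fin n) ℤ);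
      ∃ b₁ : ℕ, ∀ n k : ℕ, k ≤ Nat.log 2 n →
        ∀ Q : Literature.Computability.AlgebraicComplexity.ArithCircuit (AlgebraicClosure ℚ) (Fin n × Fin n),
          Q.IsFanInTwo →
          Q.Computes (MvPolynomial.map (Int.castRingHom (AlgebraicClosure ℚ)) (J n k)) →
          ∃ (P : Literature.Computability.AlgebraicComplexity.ArithCircuit ℤ (Fin n × Fin n)) (t M : ℕ),
            1 ≤ M ∧ P.IsFanInTwo ∧ P.Computes ((M : ℤ) • J n k) ∧
            ((∀ g ∈ P.gates, ∀ u ∈ g.args, ∀ c : ℤ, u = .const c → c.natAbs ≤ 2 ^ t) ∧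
              (∀ args : List (ℤ × Literature.Computability.AlgebraicComplexity.ArithCircuit.Operand ℤ (Fin n × Fin n)),
                Literature.Computability.AlgebraicComplexity.ArithCircuit.Gate.sum args ∈ P.gates →
                  ∀ a ∈ args, a.1.natAbs ≤ 2 ^ t) ∧
              (∀ c : ℤ, P.output = .const c → c.natAbs ≤ 2 ^ t)) ∧
            P.size + t + 2 ≤ (Q.size + n + 2) ^ b₁ ∧ padicValNat 2 M ≤ (Q.size + n + 2) ^ b₁) :
    _root_.ValiantsHypothesis :=
  closes_ultimate_twoAdic (cfUltimate_of_perModPowBooleanHard hHard)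
    (jetConstantElimUltimateTwoAdic_of stub_algebraicDescent hI stub_signSimulation)
    uniformJetUpperBound_proof

/-- **The route's target on the two open hypotheses, sharp form**:
`PerModPowBooleanHard → stub_integralMultiple₂ → JetExponentUnbounded`. CONDITIONAL. [folklore] -/
theorem jetExponentUnbounded_of_perModPowBooleanHard_of_integralMultipleTwoAdic
    (hHard : PerModPowBooleanHard)
    (hI : let J := fun (n k : ℕ) => (∑ σ : Equiv.Perm (Fin n), MvPolynomial.C (((Equiv.Perm.sign σ : ℤˣ) : ℤ) * (((Finset.univ.filter (fun p : Fin n × Fin n => p.1 < p.2 ∧ σ p.2 < σ p.1)).card.choose k : ℕ) : ℤ)) * ∏ i : Fin n, MvPolynomial.X (σ i, i) : MvPolynomial (Fin n × Fin n) ℤ);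
      ∃ b₁ : ℕ, ∀ n k : ℕ, k ≤ Nat.log 2 n →
        ∀ Q : Literature.Computability.AlgebraicComplexity.ArithCircuit (AlgebraicClosure ℚ) (Fin n × Fin n),
          Q.IsFanInTwo →
          Q.Computes (MvPolynomial.map (Int.castRingHom (AlgebraicClosure ℚ)) (J n k)) →
          ∃ (P : Literature.Computability.AlgebraicComplexity.ArithCircuit ℤ (Fin n × Fin n)) (t M : ℕ),
            1 ≤ M ∧ P.IsFanInTwo ∧ P.Computes ((M : ℤ) • J n k) ∧
            ((∀ g ∈ P.gates, ∀ u ∈ g.args, ∀ c : ℤ, u = .const c → c.natAbs ≤ 2 ^ t) ∧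
              (∀ args : List (ℤ × Literature.Computability.AlgebraicComplexity.ArithCircuit.Operand ℤ (Fin n × Fin n)),
                Literature.Computability.AlgebraicComplexity.ArithCircuit.Gate.sum args ∈ P.gates →
                  ∀ a ∈ args, a.1.natAbs ≤ 2 ^ t) ∧
              (∀ c : ℤ, P.output = .const c → c.natAbs ≤ 2 ^ t)) ∧
            P.size + t + 2 ≤ (Q.size + n + 2) ^ b₁ ∧ padicValNat 2 M ≤ (Q.size + n + 2) ^ b₁) :
    JetExponentUnbounded :=
  jetExponentUnbounded_of_ultimate_twoAdic (cfUltimate_of_perModPowBooleanHard hHard)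
    (jetConstantElimUltimateTwoAdic_of stub_algebraicDescent hI stub_signSimulation)

end Summit.ValiantsHypothesis.ValiantsHypothesis.Theorems.AnyonJets.JetConstantElim

end
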